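import Literature.Computability.Complexity.SparseSetsUpwardSeparationThm1Proofs
import Literature.Computability.Complexity.SparseSetsUpwardSeparationProofs
import HarnessLib

/-!
# Hartmanis–Immerman–Sewelson 1985, Corollary 4: sparse sets in `NP − P` iff tally sets in `NP − P` (proof)

Topic `Literature/Computability/Complexity`; discharge of the named fact
`hartmanisImmermanSewelson1985_cor4` of `SparseSetsUpwardSeparation.lean` (Information and Control 65
(1985), Cor. 4, p. 166: "There exist sparse sets in `NP − P` if and only if there exist tally sets in
`NP − P`"), exactly as the paper places it: a corollary of Theorem 1 (p. 163, discharged in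
`SparseSetsUpwardSeparationThm1Proofs.lean` as `hartmanisImmermanSewelson1985_thm1_holds`) and of
Book's tally translation (Book 1974, Thm. 1, discharged in `SparseSetsUpwardSeparationProofs.lean` as
`book1974_thm1_holds`):

* (→) a sparse set in `NP − P` gives `E ≠ NE` (Theorem 1); if every tally `NP` set were in `P` then
  `NE ⊆ E` (Book 1974, (ii) ⇒ (i)), and with `E ⊆ NE` (`E_subset_NE`) `E = NE` — contradiction;
* (←) tally sets are sparse (`IsTally.isSparseLanguage`).

## References

* J. Hartmanis, N. Immerman, V. Sewelson, *Sparse sets in NP−P: EXPTIME versus NEXPTIME*,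
  Information and Control 65 (1985) 158–181, Cor. 4 (p. 166), Thm. 1 (p. 163) (held:
  `paper:doi-10-1016-s0019-9958-85-80004-8`, PDF pp. 6, 9). [HartmanisImmermanSewelson1985]
* R. V. Book, *Tally languages and complexity classes*, Information and Control 26 (1974) 186–193,
  Thm. 1 (p. 189). [Book1974]
-/

namespace Literature.Computability.Complexity

open Literature.Barriers.PneNP (IsSparseLanguage IsTally)
open Literature.Computability.MetaComplexity (E_subset_NE)

/-- **Discharge of `hartmanisImmermanSewelson1985_cor4`** (Hartmanis–Immerman–Sewelson 1985, Cor. 4,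
p. 166: "There exist sparse sets in `NP − P` if and only if there exist tally sets in `NP − P`").
(→): by Theorem 1 (`hartmanisImmermanSewelson1985_thm1_holds`) a sparse set in `NP − P` gives
`E ≠ NE`, whereas the absence of tally sets in `NP − P` gives `NE ⊆ E` (`book1974_thm1_holds`, Book
1974, Thm. 1, (ii) ⇒ (i)) and hence `E = NE` (`E_subset_NE`); (←): tally sets are sparse
(`IsTally.isSparseLanguage`). [cite: HartmanisImmermanSewelson1985, Corollary 4 (p. 166)] -/
theorem hartmanisImmermanSewelson1985_cor4_holds : hartmanisImmermanSewelson1985_cor4 := by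
  constructor
  · intro hS
    have hne : E ≠ NE := hartmanisImmermanSewelson1985_thm1_holds.1 hS
    by_contra h
    push Not at h
    exact hne (Set.Subset.antisymm E_subset_NE (book1974_thm1_holds.2 h))
  · rintro ⟨T, hT, hNP, hP⟩
    exact ⟨T, hT.isSparseLanguage, hNP, hP⟩

end Literature.Computability.Complexity
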